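import Literature.Topology.FourManifolds.CappedBallData
import Literature.Topology.FourManifolds.FillLemma
import HarnessLib

/-!
# The collar fill: attaching the rim collar of the lid to the solid

Topic `Literature/Topology/FourManifolds`; fact seat of Alexander's theorem
(`provefact-Literature.Topology.FourManifolds.SphereEmbedding.schoenflies_exists_ball`, Schultens
(2014), Thm. 3.2.5).  **Everything in this file is proved; no definitions, no named facts.**

First move of the capped-ball step (Schultens (2014), proof of Thm. 3.2.5, PDF p. 45: the
piecewise smooth sphere `D ∪ D₁` is smoothed; here the smoothing lid pokes slightly outside the
solid `A`, and its rim collar is first attached to `A` so that the smoothed sphere lies in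
`A ∪ ∂A`): in the normal form of the step (`F = ρ² - 1` on the shell `{|ρ² - 1| ≤ w₀, |x₂| ≤ η₀}`,
`F < 0` inside the unit cylinder, `{F ≤ ε₀}` compact, `F` regular on `{F = 0}`), the fill lemma
(`FillLemma.lean`) applies to `F` and the fill weight `w` of `CappedBallData.lean`:

* `CappedBallLid.exists_pos_forall_fderiv_ne_zero` — regularity of `F` on `{F = 0}` spreads to a
  collar `{|F| ≤ δ₁}`;
* `CappedBallLid.exists_diffeomorph_collarFill` — **for `M = (1+s)² + ε₀ + 2` and all small
  `δ > 0` there is a diffeomorphism `Φ` of `ℝ³`, the identity off the closed box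
  `{ρ² ≤ (1+3s)², -6s ≤ x₂ ≤ 3s}`, with `Φ(A) = {F₂ ≤ 0}` and `Φ({F = 0}) = {F₂ = 0}`**,
  `F₂ = fillFun` the filled defining function (the hypotheses of the fill lemma hold because on
  `{F ≥ 0}` near the box `ρ² ≥ 1`, where the horizontal derivatives of `w` and of `F = ρ² - 1`
  are positive multiples of the horizontal position);
* `CappedBallLid.fillFun_eq_of_not_mem`, `isCompact_setOf_fillFun_le` — off the box (where
  `F ≤ ε₀ + 1`) `F₂ = F`, and the sublevel sets `{F₂ ≤ ε}` stay compact;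
* `CappedBallLid.hasFDerivAt_smin`, `hasFDerivAt_fillFun`, `fderiv_fillFun_ne_zero` — the
  derivative of the filled function and the regularity of its zero set.

## References

* J. Schultens, *Introduction to 3-Manifolds*, GSM 151 (2014), proof of Thm. 3.2.5 (PDF
  p. 45). [Schultens2014]
-/

open scoped RealInnerProductSpace Topology Manifold ContDiff
open Set Filter Metric Function

noncomputable section

namespace Literature.Topology.FourManifolds

namespace CappedBallLid

variable {P : ℝ → ℝ} {s δ M : ℝ}

/-! ### §1 Geometry of the boxes -/

/-- The norm squared on `ℝ³` is `ρ² + x₂²`. [folklore] -/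
theorem norm_sq_eq_hsq_add (x : EuclideanSpace ℝ (Fin 3)) : ‖x‖ ^ 2 = hsq x + x 2 ^ 2 := by
  rw [EuclideanSpace.norm_sq_eq, Fin.sum_univ_three]
  simp [hsq, Real.norm_eq_abs, sq_abs]

/-- The closed box `{ρ² ≤ (1+3s)², -6s ≤ x₂ ≤ 3s}` (the closure of `BX'`). [folklore] -/
theorem isCompact_closedBox (s : ℝ) :
    IsCompact {x : EuclideanSpace ℝ (Fin 3) | hsq x ≤ (1 + 3 * s) ^ 2 ∧ -6 * s ≤ x 2 ∧ x 2 ≤ 3 * s} := by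
  refine Metric.isCompact_of_isClosed_isBounded ?_ ?_
  · exact (isClosed_le continuous_hsq continuous_const).inter
      ((isClosed_le continuous_const (continuous_coord 2)).inter
        (isClosed_le (continuous_coord 2) continuous_const))
  · rw [Metric.isBounded_iff_subset_closedBall 0]
    refine ⟨Real.sqrt ((1 + 3 * s) ^ 2 + (6 * s) ^ 2 + (3 * s) ^ 2), fun x hx => ?_⟩
    obtain ⟨h1, h2, h3⟩ := hx
    rw [mem_closedBall, dist_zero_right, ← Real.sqrt_sq (norm_nonneg x)]
    apply Real.sqrt_le_sqrt
    rw [norm_sq_eq_hsq_add]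
    nlinarith

/-- Off the closed box the push cutoff is `1`. [folklore] -/
theorem pushCutoff_eq_one_of_not_mem {x : EuclideanSpace ℝ (Fin 3)}
    (hx : x ∉ {x : EuclideanSpace ℝ (Fin 3) | hsq x ≤ (1 + 3 * s) ^ 2 ∧ -6 * s ≤ x 2 ∧ x 2 ≤ 3 * s}) :
    (1 + 3 * s) ^ 2 ≤ hsq x ∨ x 2 ≤ -6 * s ∨ 3 * s ≤ x 2 := by
  simp only [mem_setOf_eq, not_and_or, not_le] at hx
  rcases hx with h | h | h
  · exact Or.inl h.le
  · exact Or.inr (Or.inl h.le)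
  · exact Or.inr (Or.inr h.le)

/-! ### §2 A regular collar of the zero set -/

/-- **Regularity spreads to a collar**: if `F` is `C¹`, `{F ≤ ε₀}` is compact and `DF ≠ 0` on
`{F = 0}`, then `DF ≠ 0` on `{|F| ≤ δ₁}` for some `δ₁ > 0`. [folklore] -/
theorem exists_pos_forall_fderiv_ne_zero {E : Type*} [NormedAddCommGroup E] [NormedSpace ℝ E]
    {F : E → ℝ} (hF : ContDiff ℝ 1 F) {ε₀ : ℝ} (hε₀ : 0 < ε₀) (hK : IsCompact {x | F x ≤ ε₀})
    (hreg : ∀ x, F x = 0 → fderiv ℝ F x ≠ 0) :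
    ∃ δ₁ : ℝ, 0 < δ₁ ∧ δ₁ ≤ ε₀ ∧ ∀ x, |F x| ≤ δ₁ → fderiv ℝ F x ≠ 0 := by
  set K₁ := {x | F x ≤ ε₀} ∩ {x | fderiv ℝ F x = 0} with hK₁
  have hFc : Continuous F := hF.continuous
  have hcl : IsClosed {x | fderiv ℝ F x = 0} :=
    isClosed_eq (hF.continuous_fderiv (by simp)) continuous_const
  have hK₁c : IsCompact K₁ := hK.inter_right hcl
  by_cases hne : K₁.Nonempty
  · obtain ⟨x₀, hx₀, hmin⟩ := hK₁c.exists_isMinOn hne (continuous_abs.comp hFc).continuousOn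
    have hpos : 0 < |F x₀| := by
      rw [abs_pos]
      exact fun h0 => hreg x₀ h0 hx₀.2
    refine ⟨min (|F x₀| / 2) ε₀, lt_min (by linarith) hε₀, min_le_right _ _, fun x hx hDF => ?_⟩
    have hxK : x ∈ K₁ := ⟨le_trans (le_abs_self _) (hx.trans (min_le_right _ _)), hDF⟩
    have h' : |F x₀| ≤ |F x| := hmin hxK
    linarith [min_le_left (|F x₀| / 2) ε₀]
  · refine ⟨ε₀, hε₀, le_rfl, fun x hx hDF => hne ⟨x, le_trans (le_abs_self _) hx, hDF⟩⟩

/-! ### §3 The collar fill -/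

section Fill

variable {F : EuclideanSpace ℝ (Fin 3) → ℝ} {ε₀ w₀ η₀ : ℝ}

/-- The horizontal position vector `(x₀, x₁, 0)`. [folklore] -/
theorem exists_horizontal (x : EuclideanSpace ℝ (Fin 3)) :
    ∃ u : EuclideanSpace ℝ (Fin 3), u 0 = x 0 ∧ u 1 = x 1 ∧ u 2 = 0 :=
  ⟨x 0 • EuclideanSpace.single (0 : Fin 3) (1 : ℝ) + x 1 • EuclideanSpace.single (1 : Fin 3) (1 : ℝ),
    by simp, by simp, by simp⟩

/-- In the closed box, points with `ρ² ≥ 1` lie in the interior of the straightened shell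
`{|ρ² - 1| ≤ w₀, |x₂| ≤ η₀}` (`8s ≤ w₀`, `7s ≤ η₀`, `s ≤ 1/8`), so the defining function is
`ρ² - 1` near them and its derivative is `dhsq`. [folklore] -/
theorem fderiv_eq_dhsq_of_mem_box (hs : 0 < s) (hs1 : s ≤ 1 / 8)
    (hsw : 8 * s ≤ w₀) (hsη : 7 * s ≤ η₀)
    (hNFa : ∀ x, |hsq x - 1| ≤ w₀ → |x 2| ≤ η₀ → F x = hsq x - 1)
    {x : EuclideanSpace ℝ (Fin 3)} (h1 : 1 ≤ hsq x) (h2 : hsq x ≤ (1 + 3 * s) ^ 2)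
    (h3 : -6 * s ≤ x 2) (h4 : x 2 ≤ 3 * s) :
    F x = hsq x - 1 ∧ fderiv ℝ F x = dhsq x := by
  have hlt : hsq x - 1 < w₀ := by nlinarith
  have hev : F =ᶠ[𝓝 x] fun y => hsq y - 1 := by
    have hopen : IsOpen {y : EuclideanSpace ℝ (Fin 3) | |hsq y - 1| < w₀ ∧ |y 2| < η₀} :=
      (isOpen_lt (continuous_abs.comp (continuous_hsq.sub continuous_const))
        continuous_const).inter
        (isOpen_lt (continuous_abs.comp (continuous_coord 2)) continuous_const)
    have hxmem : x ∈ {y : EuclideanSpace ℝ (Fin 3) | |hsq y - 1| < w₀ ∧ |y 2| < η₀} := by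
      refine ⟨abs_lt.2 ⟨by linarith, hlt⟩, abs_lt.2 ⟨by linarith, by linarith⟩⟩
    filter_upwards [hopen.mem_nhds hxmem] with y hy
    exact hNFa y hy.1.le hy.2.le
  refine ⟨hev.self_of_nhds, ?_⟩
  rw [hev.fderiv_eq]
  exact ((hasFDerivAt_hsq x).sub_const 1).fderiv

/-- **The collar fill.**  Let `A = {F ≤ 0}` be in normal form near the unit circle at height
`0` — `F = ρ² - 1` on the shell `{|ρ² - 1| ≤ w₀, |x₂| ≤ η₀}`, `F < 0` inside the unit cylinder
and `F` regular on `{F = 0}` with `{F ≤ ε₀}` compact — and let `G` be the lid function of scale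
`s` (`8s ≤ w₀`, `7s ≤ η₀`, `s ≤ 1/8`).  Then for `M = (1+s)² + ε₀ + 2` and all small `δ > 0` the
fill lemma applies to `F` and the fill weight `w`: there is a diffeomorphism `Φ` of `ℝ³`, the
identity off the closed box `{ρ² ≤ (1+3s)², -6s ≤ x₂ ≤ 3s}`, with `Φ(A) = {F₂ ≤ 0}` and
`Φ({F = 0}) = {F₂ = 0}`, `F₂ = F ⊓_δ (w - 1)` the filled defining function — the solid `A` with the
rim collar of the lid solid attached and all corners rounded.  (The hypotheses of the fill lemma
hold because on `{F ≥ 0}` near the box `ρ² ≥ 1`, and there the horizontal derivatives of `w`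
and of `F = ρ² - 1` are positive multiples of the horizontal position.) [folklore] -/
theorem exists_diffeomorph_collarFill (hP : ContDiff ℝ ∞ P) (hP0 : ∀ t, t ≤ -1 → P t = 0)
    (hP1 : ∀ t, 1 ≤ t → P t = t) (hPd : ∀ t, 0 ≤ deriv P t ∧ deriv P t ≤ 1)
    (hPge : ∀ t, max 0 t ≤ P t) (hPle : ∀ t, P t ≤ max 0 t + 1)
    (hF : ContDiff ℝ ∞ F) (hε₀ : 0 < ε₀) (hKε : IsCompact {x | F x ≤ ε₀})
    (hreg : ∀ x, F x = 0 → fderiv ℝ F x ≠ 0)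
    (hs : 0 < s) (hs1 : s ≤ 1 / 8) (hsw : 8 * s ≤ w₀) (hsη : 7 * s ≤ η₀)
    (hNFa : ∀ x, |hsq x - 1| ≤ w₀ → |x 2| ≤ η₀ → F x = hsq x - 1)
    (hNFb : ∀ x, hsq x < 1 → |x 2| ≤ η₀ → F x < 0) :
    ∃ δ₀ : ℝ, 0 < δ₀ ∧ δ₀ < ε₀ ∧ ∀ δ, 0 < δ → δ ≤ δ₀ →
      ∃ Φ : EuclideanSpace ℝ (Fin 3) ≃ₘ⟮𝓘(ℝ, EuclideanSpace ℝ (Fin 3)),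
          𝓘(ℝ, EuclideanSpace ℝ (Fin 3))⟯ EuclideanSpace ℝ (Fin 3),
        Φ '' {x | F x ≤ 0} = {x | fillFun F P s δ ((1 + s) ^ 2 + ε₀ + 2) x ≤ 0} ∧
        Φ '' {x | F x = 0} = {x | fillFun F P s δ ((1 + s) ^ 2 + ε₀ + 2) x = 0} ∧
        ∀ x, x ∉ {x : EuclideanSpace ℝ (Fin 3) | hsq x ≤ (1 + 3 * s) ^ 2 ∧ -6 * s ≤ x 2 ∧ x 2 ≤ 3 * s} →
          Φ x = x := by
  set M := (1 + s) ^ 2 + ε₀ + 2 with hM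
  have hM0 : 0 ≤ M := by positivity
  have hPdiff : Differentiable ℝ P := hP.differentiable (by simp)
  set CB := {x : EuclideanSpace ℝ (Fin 3) | hsq x ≤ (1 + 3 * s) ^ 2 ∧ -6 * s ≤ x 2 ∧ x 2 ≤ 3 * s}
    with hCB
  -- regular collar
  obtain ⟨δ₁, hδ₁, hδ₁ε, hδ₁reg⟩ :=
    exists_pos_forall_fderiv_ne_zero (hF.of_le (by norm_cast)) hε₀ hKε hreg
  refine ⟨min (min (δ₁ / 2) (ε₀ / 2)) 1, lt_min (lt_min (by linarith) (by linarith)) one_pos,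
    lt_of_le_of_lt ((min_le_left _ _).trans (min_le_right _ _)) (by linarith),
    fun δ hδ hδle => ?_⟩
  have hδa : δ ≤ δ₁ / 2 := hδle.trans ((min_le_left _ _).trans (min_le_left _ _))
  have hδb : δ ≤ ε₀ / 2 := hδle.trans ((min_le_left _ _).trans (min_le_right _ _))
  have hδc : δ ≤ 1 := hδle.trans (min_le_right _ _)
  have hδ₁' : 2 * δ ≤ δ₁ := by linarith
  have hδε : δ < ε₀ := by linarith
  set w := fillWeight P s δ M with hw
  have hwsmooth : ContDiff ℝ ∞ w := contDiff_fillWeight hP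
  -- `w` is large off the closed box
  have hwfar : ∀ x, x ∉ CB → 1 + ε₀ + 2 ≤ w x := by
    intro x hx
    have h1 := fillWeight_ge_of_not_mem hs hδ.le (P := P) (M := M) (pushCutoff_eq_one_of_not_mem hx)
    have h2 := neg_sq_le_lidFun hs hPge x (P := P)
    rw [hw]
    linarith
  -- the compact set `K`
  set K := {x | F x ≤ ε₀} ∪ CB with hK
  have hKc : IsCompact K := hKε.union (isCompact_closedBox s)
  have hKF : ∀ x, F x ≤ ε₀ → x ∈ K := fun x hx => Or.inl hx
  have hKw : ∀ x, w x ≤ 1 + ε₀ → x ∈ K := by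
    intro x hx
    by_contra hxK
    have : x ∉ CB := fun h => hxK (Or.inr h)
    linarith [hwfar x this]
  -- points of the hypotheses region lie in the box and have `ρ² ≥ 1`
  have hmemCB : ∀ x, w x ≤ 1 + 2 * δ → x ∈ CB := by
    intro x hx
    by_contra hxCB
    linarith [hwfar x hxCB]
  have hbox : ∀ x, 0 ≤ F x → w x ≤ 1 + 2 * δ →
      1 ≤ hsq x ∧ hsq x ≤ (1 + 3 * s) ^ 2 ∧ -6 * s ≤ x 2 ∧ x 2 ≤ 3 * s := by
    intro x hFx hwx
    obtain ⟨h1, h2, h3⟩ := hmemCB x hwx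
    refine ⟨?_, h1, h2, h3⟩
    by_contra hlt
    exact absurd hFx (not_le.2 (hNFb x (not_le.1 hlt) (abs_le.2 ⟨by linarith, by linarith⟩)))
  -- the horizontal derivative of `w` at such points is positive on the position vector
  have hcoef : ∀ x, 2 * s ≤ (2 * s * (1 - deriv P ((rimFun s x - topFun s x) / (s / 8))) +
      2 * deriv P ((rimFun s x - topFun s x) / (s / 8))) +
      2 * M * (deriv (latCutoff s) (hsq x) * (1 - vertCutoff s (x 2))) := by
    intro x
    have h1 := two_mul_le_horizCoeff (s := s) (P := P) hPd (by linarith) x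
    have h2 : 0 ≤ deriv (latCutoff s) (hsq x) * (1 - vertCutoff s (x 2)) :=
      mul_nonneg (deriv_latCutoff_nonneg hs _) (sub_nonneg.2 (vertCutoff_mem_Icc hs _).2)
    nlinarith [mul_nonneg hM0 h2]
  have hwu : ∀ x, 1 ≤ hsq x → ∃ u : EuclideanSpace ℝ (Fin 3), u 2 = 0 ∧ 0 < fderiv ℝ w x u ∧
      dhsq x u = 2 * hsq x := by
    intro x hx
    obtain ⟨u, hu0, hu1, hu2⟩ := exists_horizontal x
    refine ⟨u, hu2, ?_, ?_⟩
    · rw [hw, fderiv_fillWeight_apply_of_coord_two_eq_zero hPdiff hs x hu2, hu0, hu1]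
      have hh : x 0 * x 0 + x 1 * x 1 = hsq x := by simp [hsq, sq]
      rw [hh]
      have := hcoef x
      nlinarith
    · rw [dhsq_apply, hu0, hu1]
      simp [hsq, sq]
      ring
  -- the three hypotheses of the fill lemma
  have H1 : ∀ x, 0 ≤ F x → F x ≤ 2 * δ → fderiv ℝ F x ≠ 0 := fun x h0 h2 =>
    hδ₁reg x (by rw [abs_of_nonneg h0]; linarith)
  have H2 : ∀ x, 0 ≤ F x → w x ≤ 1 + 2 * δ → fderiv ℝ w x ≠ 0 := by
    intro x hFx hwx hzero
    obtain ⟨h1, -, -, -⟩ := hbox x hFx hwx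
    obtain ⟨u, -, hu, -⟩ := hwu x h1
    rw [hzero] at hu
    simp at hu
  have H3 : ∀ x, 0 ≤ F x → F x ≤ 2 * δ → w x ≤ 1 + 2 * δ → ∀ c : ℝ, c < 0 →
      fderiv ℝ w x ≠ c • fderiv ℝ F x := by
    intro x hFx _ hwx c hc heq
    obtain ⟨h1, h2, h3, h4⟩ := hbox x hFx hwx
    obtain ⟨-, hDF⟩ := fderiv_eq_dhsq_of_mem_box hs hs1 hsw hsη hNFa h1 h2 h3 h4
    obtain ⟨u, -, hu, hdu⟩ := hwu x h1
    have := congrArg (fun A : EuclideanSpace ℝ (Fin 3) →L[ℝ] ℝ => A u) heq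
    simp only [FunLike.coe_smul, Pi.smul_apply, smul_eq_mul, hDF, hdu] at this
    nlinarith
  obtain ⟨Φ, hΦA, hΦZ, hΦid, hΦK⟩ := SmoothMax.exists_diffeomorph_image_fill hP hP0 hP1 hPd hPge
    hPle hF hwsmooth hKc hKF hKw hδ hδε H1 H2 H3
  refine ⟨Φ, hΦA, hΦZ, fun x hx => ?_⟩
  by_cases hxK : x ∈ K
  · rcases hxK with hxF | hxCB
    · exact hΦid x (by linarith [hwfar x hx, show F x ≤ ε₀ from hxF])
    · exact absurd hxCB hx
  · exact hΦK x hxK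

/-- Off the closed box, and wherever `F ≤ ε₀ + 1`, the filled defining function is `F` (for
`M = (1+s)² + ε₀ + 2`, `δ ≤ 1`). [folklore] -/
theorem fillFun_eq_of_not_mem (hP0 : ∀ t, t ≤ -1 → P t = 0) (hPge : ∀ t, max 0 t ≤ P t)
    (hs : 0 < s) (hδ : 0 < δ) (hδ1 : δ ≤ 1) {x : EuclideanSpace ℝ (Fin 3)}
    (hx : x ∉ {x : EuclideanSpace ℝ (Fin 3) | hsq x ≤ (1 + 3 * s) ^ 2 ∧ -6 * s ≤ x 2 ∧ x 2 ≤ 3 * s})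
    (hFx : F x ≤ ε₀ + 1) :
    fillFun F P s δ ((1 + s) ^ 2 + ε₀ + 2) x = F x := by
  refine fillFun_eq_left hP0 hδ ?_
  have h1 := fillWeight_ge_of_not_mem hs hδ.le (P := P) (M := (1 + s) ^ 2 + ε₀ + 2)
    (pushCutoff_eq_one_of_not_mem hx)
  have h2 := neg_sq_le_lidFun hs hPge x (P := P)
  linarith

/-- The sublevel sets `{F₂ ≤ ε}` of the filled function are compact for small `ε`
(`{F₂ ≤ ε} ⊆ {F ≤ ε + δ} ∪ {w ≤ 1 + ε + δ}`). [folklore] -/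
theorem isCompact_setOf_fillFun_le (hP : ContDiff ℝ ∞ P) (hPle : ∀ t, P t ≤ max 0 t + 1)
    (hPge : ∀ t, max 0 t ≤ P t) (hF : ContDiff ℝ ∞ F)
    (hs : 0 < s) (hδ : 0 < δ) (hKε : IsCompact {x | F x ≤ ε₀})
    {ε : ℝ} (hε : ε + δ ≤ ε₀) :
    IsCompact {x | fillFun F P s δ ((1 + s) ^ 2 + ε₀ + 2) x ≤ ε} := by
  have hcl : IsClosed {x | fillFun F P s δ ((1 + s) ^ 2 + ε₀ + 2) x ≤ ε} :=
    isClosed_le (contDiff_fillFun hF hP).continuous continuous_const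
  refine (hKε.union (isCompact_closedBox s)).of_isClosed_subset hcl fun x hx => ?_
  have hmin := min_sub_le_fillFun hPle hδ (F := F) (s := s) (M := (1 + s) ^ 2 + ε₀ + 2) x (P := P)
  have hx' : fillFun F P s δ ((1 + s) ^ 2 + ε₀ + 2) x ≤ ε := hx
  by_cases hxCB : x ∈ {x : EuclideanSpace ℝ (Fin 3) | hsq x ≤ (1 + 3 * s) ^ 2 ∧ -6 * s ≤ x 2 ∧ x 2 ≤ 3 * s}
  · exact Or.inr hxCB
  · left
    have h1 := fillWeight_ge_of_not_mem hs hδ.le (P := P) (M := (1 + s) ^ 2 + ε₀ + 2)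
      (pushCutoff_eq_one_of_not_mem hxCB)
    have h2 := neg_sq_le_lidFun hs hPge x (P := P)
    have hwbig : ε + δ < fillWeight P s δ ((1 + s) ^ 2 + ε₀ + 2) x - 1 := by linarith
    show F x ≤ ε₀
    by_contra hFx
    push Not at hFx
    have : ε + δ < min (F x) (fillWeight P s δ ((1 + s) ^ 2 + ε₀ + 2) x - 1) :=
      lt_min (by linarith) hwbig
    linarith

/-! ### §4 The derivative of the filled defining function; regularity of its zero set -/

/-- **The derivative of a smooth minimum** `F ⊓_δ ℓ = F - δ P((F - ℓ)/δ)`: the convex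
combination `(1 - θ) DF + θ Dℓ`, `θ = P'((F - ℓ)/δ)`. [folklore] -/
theorem hasFDerivAt_smin {E : Type*} [NormedAddCommGroup E] [NormedSpace ℝ E] {P : ℝ → ℝ}
    (hPd : Differentiable ℝ P) {δ : ℝ} (hδ : δ ≠ 0) {F ℓ : E → ℝ} {F' ℓ' : E →L[ℝ] ℝ} {x : E}
    (hF : HasFDerivAt F F' x) (hℓ : HasFDerivAt ℓ ℓ' x) :
    HasFDerivAt (fun y => F y - δ * P ((F y - ℓ y) / δ))
      ((1 - deriv P ((F x - ℓ x) / δ)) • F' + deriv P ((F x - ℓ x) / δ) • ℓ') x := by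
  have h1 : HasFDerivAt (fun y => (F y - ℓ y) / δ) (δ⁻¹ • (F' - ℓ')) x :=
    (hF.sub hℓ).mul_const δ⁻¹
  have h2 := (hPd ((F x - ℓ x) / δ)).hasDerivAt.hasFDerivAt.comp x h1
  have h3 := hF.sub (h2.const_mul δ)
  refine h3.congr_fderiv ?_
  ext v
  simp [ContinuousLinearMap.toSpanSingleton_apply]
  field_simp
  ring

/-- The derivative of the filled defining function. [folklore] -/
theorem hasFDerivAt_fillFun (hPd : Differentiable ℝ P) (hδ : δ ≠ 0)
    (hFd : Differentiable ℝ F) (hP : ContDiff ℝ ∞ P) (x : EuclideanSpace ℝ (Fin 3)) :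
    HasFDerivAt (fillFun F P s δ M)
      ((1 - deriv P ((F x - (fillWeight P s δ M x - 1)) / δ)) • fderiv ℝ F x +
        deriv P ((F x - (fillWeight P s δ M x - 1)) / δ) • fderiv ℝ (fillWeight P s δ M) x) x := by
  unfold fillFun
  have hw : HasFDerivAt (fun y => fillWeight P s δ M y - 1) (fderiv ℝ (fillWeight P s δ M) x) x := by
    simpa using ((contDiff_fillWeight hP).differentiable (by simp) x).hasFDerivAt.sub_const 1
  exact hasFDerivAt_smin hPd hδ (hFd x).hasFDerivAt hw

/-- **The zero set of the filled defining function is regular** (for `M = (1+s)² + ε₀ + 2` and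
the `δ` of the collar fill): off the box `F₂ = F` near its zeros; in the box a zero has `ρ² ≥ 1`
and the horizontal derivative of `F₂`, a convex combination of those of `F = ρ² - 1` and `w`, is a
positive multiple of the horizontal position. [folklore] -/
theorem fderiv_fillFun_ne_zero (hP : ContDiff ℝ ∞ P) (hP0 : ∀ t, t ≤ -1 → P t = 0)
    (hPd : ∀ t, 0 ≤ deriv P t ∧ deriv P t ≤ 1) (hPge : ∀ t, max 0 t ≤ P t)
    (hPle : ∀ t, P t ≤ max 0 t + 1) (hF : ContDiff ℝ ∞ F) (hε₀ : 0 < ε₀)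
    (hreg : ∀ x, F x = 0 → fderiv ℝ F x ≠ 0)
    (hs : 0 < s) (hs1 : s ≤ 1 / 8) (hsw : 8 * s ≤ w₀) (hsη : 7 * s ≤ η₀)
    (hNFa : ∀ x, |hsq x - 1| ≤ w₀ → |x 2| ≤ η₀ → F x = hsq x - 1)
    (hNFb : ∀ x, hsq x < 1 → |x 2| ≤ η₀ → F x < 0) (hδ : 0 < δ) (hδ1 : δ ≤ 1)
    {x : EuclideanSpace ℝ (Fin 3)} (hx : fillFun F P s δ ((1 + s) ^ 2 + ε₀ + 2) x = 0) :
    fderiv ℝ (fillFun F P s δ ((1 + s) ^ 2 + ε₀ + 2)) x ≠ 0 := by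
  set M := (1 + s) ^ 2 + ε₀ + 2 with hM
  have hM0 : 0 ≤ M := by positivity
  have hPdiff : Differentiable ℝ P := hP.differentiable (by simp)
  have hFd : Differentiable ℝ F := hF.differentiable (by simp)
  set CB := {x : EuclideanSpace ℝ (Fin 3) | hsq x ≤ (1 + 3 * s) ^ 2 ∧ -6 * s ≤ x 2 ∧ x 2 ≤ 3 * s}
    with hCB
  by_cases hxCB : x ∈ CB
  · -- in the box: `F x ≥ 0`, so `ρ² ≥ 1`
    obtain ⟨h1, h2, h3⟩ := hxCB
    have hmin := min_sub_le_fillFun hPle hδ (F := F) (s := s) (M := M) x (P := P)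
    have hle := fillFun_le_min hPge hδ (F := F) (s := s) (M := M) x (P := P)
    have hF0 : 0 ≤ F x := by
      have : (0 : ℝ) ≤ min (F x) (fillWeight P s δ M x - 1) := by rw [← hx]; exact hle
      exact this.trans (min_le_left _ _)
    have hhsq : 1 ≤ hsq x := by
      by_contra hlt
      exact absurd hF0 (not_le.2 (hNFb x (not_le.1 hlt) (abs_le.2 ⟨by linarith, by linarith⟩)))
    obtain ⟨-, hDF⟩ := fderiv_eq_dhsq_of_mem_box hs hs1 hsw hsη hNFa hhsq h1 h2 h3
    obtain ⟨u, hu0, hu1, hu2⟩ := exists_horizontal x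
    intro hzero
    have hderiv := (hasFDerivAt_fillFun hPdiff hδ.ne' hFd hP x (s := s) (M := M)).fderiv
    rw [hzero] at hderiv
    have := congrArg (fun A : EuclideanSpace ℝ (Fin 3) →L[ℝ] ℝ => A u) hderiv
    simp only [zero_apply, add_apply, FunLike.coe_smul, Pi.smul_apply, smul_eq_mul, hDF,
      dhsq_apply, fderiv_fillWeight_apply_of_coord_two_eq_zero hPdiff hs x hu2, hu0, hu1] at this
    set θ := deriv P ((F x - (fillWeight P s δ M x - 1)) / δ) with hθ
    obtain ⟨hθ0, hθ1⟩ := hPd ((F x - (fillWeight P s δ M x - 1)) / δ)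
    have hcoef : 2 * s ≤ (2 * s * (1 - deriv P ((rimFun s x - topFun s x) / (s / 8))) +
        2 * deriv P ((rimFun s x - topFun s x) / (s / 8))) +
        2 * M * (deriv (latCutoff s) (hsq x) * (1 - vertCutoff s (x 2))) := by
      have h1 := two_mul_le_horizCoeff (s := s) (P := P) hPd (by linarith) x
      have h2 : 0 ≤ deriv (latCutoff s) (hsq x) * (1 - vertCutoff s (x 2)) :=
        mul_nonneg (deriv_latCutoff_nonneg hs _) (sub_nonneg.2 (vertCutoff_mem_Icc hs _).2)
      nlinarith [mul_nonneg hM0 h2]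
    have hh : x 0 * x 0 + x 1 * x 1 = hsq x := by simp [hsq, sq]
    have hh2 : 2 * x 0 * x 0 + 2 * x 1 * x 1 = 2 * hsq x := by simp [hsq, sq]; ring
    rw [hh, hh2] at this
    -- `0 = (1 - θ)(2 hsq) + θ · coef · hsq` with `hsq ≥ 1`, `coef ≥ 2s`, `θ ∈ [0,1]`
    nlinarith [mul_nonneg hθ0 (by linarith : (0:ℝ) ≤ hsq x),
      mul_nonneg (sub_nonneg.2 hθ1) (by linarith : (0:ℝ) ≤ hsq x),
      mul_nonneg (mul_nonneg hθ0 (by linarith : (0:ℝ) ≤ hsq x)) (by linarith : (0:ℝ) ≤ 2 * s)]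
  · -- off the box: `F₂ = F` near `x`
    have hFx : F x ≤ 1 := by
      by_contra hgt
      push Not at hgt
      have hmin := min_sub_le_fillFun hPle hδ (F := F) (s := s) (M := M) x (P := P)
      have h1 := fillWeight_ge_of_not_mem hs hδ.le (P := P) (M := M) (pushCutoff_eq_one_of_not_mem hxCB)
      have h2 := neg_sq_le_lidFun hs hPge x (P := P)
      have : 1 < min (F x) (fillWeight P s δ M x - 1) := lt_min hgt (by rw [hM] at h1; linarith)
      linarith
    have hev : fillFun F P s δ M =ᶠ[𝓝 x] F := by
      have hopen : IsOpen (CBᶜ ∩ {y | F y < ε₀ + 1}) :=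
        (isCompact_closedBox s).isClosed.isOpen_compl.inter (isOpen_lt hF.continuous continuous_const)
      filter_upwards [hopen.mem_nhds ⟨hxCB, by show F x < ε₀ + 1; linarith⟩] with y hy
      refine fillFun_eq_left hP0 hδ ?_
      have h1 := fillWeight_ge_of_not_mem hs hδ.le (P := P) (M := M) (pushCutoff_eq_one_of_not_mem hy.1)
      have h2 := neg_sq_le_lidFun hs hPge y (P := P)
      have h3 : F y < ε₀ + 1 := hy.2
      rw [hM] at h1
      linarith
    rw [hev.fderiv_eq]
    exact hreg x (by rw [← hev.self_of_nhds]; exact hx)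

end Fill

end CappedBallLid

end Literature.Topology.FourManifolds

end
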